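import Literature.AnabelianGeometry.EtaleTheta.SettingModelTateDoubleUnderline
import Literature.AnabelianGeometry.EtaleTheta.SettingModelPowHat
import Literature.AnabelianGeometry.EtaleTheta.SettingModelChiTate2
import Literature.AnabelianGeometry.EtaleTheta.SettingModelThetaCentreZHat
import Literature.AnabelianGeometry.EtaleTheta.SettingModelChiBarKerHuu
import Literature.AnabelianGeometry.EtaleTheta.Discharge.Sec2PiCHatSlimModelKrull
import HarnessLib

/-!
# [EtTh] Cor. 2.18 (i) at the stage-2 Tate model `ThetaSetting.modelχq p i j`: the PROFINITE-INNER automorphisms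
# `α_h = Ad(inl h)|_{Π^tp_X}` (`h ∈ F̂₂`) of the tempered `Π^tp_X`, what they preserve, and where they are not inner
# (proof-only tools for the row «(β1)-REFUTED-AT-MODEL»; sequel: `Sec2Cor218AdmissibleAutNotInnerGaloisAtModelChi`)

S. Mochizuki, *The étale theta function and its Frobenioid-theoretic manifestations*, Publ. RIMS **45** (2009)
[EtTh], §1 p. 12 («`Π_X := (Π^tp_X)^∧`», «`Δ_X` … a profinite free group on 2 generators»), Cor. 2.18 (i) p. 60
(clauses (4), (5): stability of `Ker(Π^tp_X̲̲ ↠ (Π^tp_X)^Θ)` and of `θ⁻¹(l·Δ_Θ)`), Thm. 1.6 (i) p. 24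
(`γ(Π^tp_Ÿ) = Π^tp_Ÿ`) [cite: MochizukiEtTh2009, Cor 2.18(i) p.60].

abc-iut cell, layer L6 / K-L6 row «COR219III-M1b», sub-row «(β1)-REFUTED-AT-MODEL» (abc-iut-L6-lead §F v1.19dn),
seat abc-iut-w5-d125 (gen 11), FILE 1 of 2. PROOF-ONLY: no `def`, no instance, no notation, no new `Prop`-valued
fact; constructions live inside `∃`-proofs. Inputs BY NAME: abc-iut-w5-d249's F4q (`PiTpχq = Γ ⋊_{actχq} G_{ℚ_p}`,
`toHatχq`, `continuous_actHatχq_left`, `eHat_actHatχq`), abc-iut-L2-t5's F5q (`YNχq`), abc-iut-L2-d1's `Huuχq` /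
`mem_Huuχq_iff` / `mem_thetaKerχq_iff` / `mem_ellKerχq_iff`, abc-iut-w5-d024's `powHat` / `map_powHat` /
`apply_powHat_eq_pow` / `powHat_unique`, abc-iut-L2-t6's `hHat_bPow` / `affTwist₃_eta_of_one`, the `Ẑ`-lemmas
`exists_pow_sq_ne_eta` / `exists_aPowHat` / `eHat_conj` / `zh_eq_one_of_forall_level`, `Heis.pow_eq_one_of_odd` /
`Heis.pow_eq_mk`.

WHAT IS PROVED (numbers, not adjectives).
* §1 `exists_conjHatAutχq` — for EVERY `h ∈ F̂₂`, conjugation by `inl h` in the profinite `Π_X = F̂₂ ⋊ G_{ℚ_p}`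
  restricts along `toHatχq : Π^tp_X ↪ Π_X` to a bi-continuous automorphism `α_h` of the TEMPERED
  `Π^tp_X = Γ ⋊_{actχq} G_{ℚ_p}` (`Γ = F̂₂ ×_Ẑ ℤ`): `α_h ⟨(x, n), σ⟩ = ⟨(h·x·(σ·h)⁻¹, n), σ⟩` — possible because `ê` is
  conjugation- and `actχq`-invariant.  A MODEL ARTEFACT: `pr₁(Γ) ⊊ F̂₂` is normalised by all of `F̂₂`, whereas for a
  genuine tempered `π₁` one has `N_{Π̂}(Π^tp) = Π^tp` (cf. the tree's `IsFreeOrSurface.isNormallyTerminal_range_toCompletion`).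
  Coordinates: `α_h` is over the identity of `G_{ℚ_p}` (`right_eq_of_conjHat`), preserves the degree `Γ ↠ ℤ`
  (`gfpSnd_left_eq_of_conjHat`), preserves `ĥ_N ∘ pr₁` at every level `N` with `ĥ_N(h) = ĥ_N(σ·h) = 1`
  (`levelHom_left_eq_of_conjHat`), and induces the identity on `θ(Ker(Π^tp_X ↠ (Π^tp_X)^ell))` (`ellKer_of_conjHat`);
  hence it stabilises `Ker(↠ Θ)`, `Ker(↠ ell)`, `Π^tp_{Y_2}` and the record `Π^tp_X̲̲ = Huuχq` (`conjHat_mem_*_iff`).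
* §2 THE WITNESS `h := a^{s′}`, `s′ := (s^{2l})² ∈ 4l·Ẑ ∖ ℤ` (`exists_aPow_conjHat_witness`): `ê(h) = s′ ∉ ℤ` and
  `ĥ_N(h) = ĥ_N(σ·h) = 1` at `N = l` (odd, exponent `l`) and `N = 2` (exponent `4`), via `σ·a^{s′} = (σ·a)^{s′}`.
* §3 `conjHat_inl_b_ne_conj` — if `ê(h) ∉ ℤ` then `α_h(b) ≠ w b w⁻¹` for EVERY `w ∈ Π^tp_X` (read in `Heis(ℤ/N)`:
  `(0, 1, ê(h)_N) = (0, χ_N(σ), χ_N(σ)·deg w₁)` would force `ê(h) ≡ deg w₁ (mod N)` for all `N`, i.e. `ê(h) ∈ ℤ`).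

HONEST LABEL: statements about OUR semi-synthetic model of the typed [EtTh] §1 interface only (consistency /
non-vacuity tooling); nothing of [EtTh] (refereed) is asserted; no side is taken on [IUTchIII] Cor. 3.12; typed ≠
proved; nothing here asserts abc proved or refuted.
-/

noncomputable section

namespace Literature.AnabelianGeometry.EtaleTheta

namespace SettingModel

open Literature.AnabelianGeometry.SemiGraphs _root_.Function _root_.Topology

variable (p : ℕ) [hp : Fact p.Prime] (i j : ℤ)

/-! ## §1. Conjugation by `inl h` (`h ∈ F̂₂`) in `Π_X` restricts to a bi-continuous automorphism of `Π^tp_X` -/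

/-- Conjugating `inl q` inside a semidirect product: `g · inl q · g⁻¹ = inl (g.left · (g.right · q) · g.left⁻¹)`
(the carrier-generic form of abc-iut-w5-d051's `conj_inl_eqq`). [folklore] -/
private theorem conj_inl_eq_sd {N G : Type*} [Group N] [Group G] {φ : G →* MulAut N} (g : N ⋊[φ] G) (q : N) :
    g * SemidirectProduct.inl q * g⁻¹ = SemidirectProduct.inl (g.left * φ g.right q * g.left⁻¹) := by
  have h1 : (SemidirectProduct.inr g.right : N ⋊[φ] G) * SemidirectProduct.inl q *
      (SemidirectProduct.inr g.right)⁻¹ = SemidirectProduct.inl (φ g.right q) := by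
    rw [← map_inv, ← SemidirectProduct.inl_aut]
  calc g * SemidirectProduct.inl q * g⁻¹
      = (SemidirectProduct.inl g.left * SemidirectProduct.inr g.right) * SemidirectProduct.inl q *
          (SemidirectProduct.inl g.left * SemidirectProduct.inr g.right)⁻¹ := by
        rw [SemidirectProduct.inl_left_mul_inr_right]
    _ = SemidirectProduct.inl g.left *
          ((SemidirectProduct.inr g.right : N ⋊[φ] G) * SemidirectProduct.inl q *
            (SemidirectProduct.inr g.right)⁻¹) *
          (SemidirectProduct.inl g.left)⁻¹ := by group
    _ = SemidirectProduct.inl (g.left * φ g.right q * g.left⁻¹) := by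
        rw [h1, ← map_inv, ← map_mul, ← map_mul]

/-- The two coordinates of `inl h · y · (inl h)⁻¹` in a semidirect product. [folklore] -/
private theorem inl_mul_mul_inl_inv_left {N G : Type*} [Group N] [Group G] {φ : G →* MulAut N} (h : N)
    (y : N ⋊[φ] G) : (SemidirectProduct.inl h * y * (SemidirectProduct.inl h)⁻¹).left = h * y.left * (φ y.right h)⁻¹ := by
  rw [SemidirectProduct.mul_left, SemidirectProduct.mul_left, SemidirectProduct.inv_left, SemidirectProduct.left_inl,
    SemidirectProduct.right_inl, SemidirectProduct.mul_right, SemidirectProduct.right_inl, map_one, MulAut.one_apply,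
    inv_one, one_mul, map_one, MulAut.one_apply, map_inv]

/-- [folklore] -/
private theorem inl_mul_mul_inl_inv_right {N G : Type*} [Group N] [Group G] {φ : G →* MulAut N} (h : N)
    (y : N ⋊[φ] G) : (SemidirectProduct.inl h * y * (SemidirectProduct.inl h)⁻¹).right = y.right := by
  rw [SemidirectProduct.mul_right, SemidirectProduct.mul_right, SemidirectProduct.inv_right,
    SemidirectProduct.right_inl, inv_one, one_mul, mul_one]

/-- **Conjugation by `inl h`, `h ∈ F̂₂`, in `Π_X = F̂₂ ⋊ G_{ℚ_p}` restricts to a topological automorphism of the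
tempered `Π^tp_X = Γ ⋊_{actχq} G_{ℚ_p}`** (read in `Π_X` along `toHatχq`): `ê` is conjugation-invariant
(`eHat_conj`) and `actχq`-invariant (`eHat_actHatχq`), so `(x, n) ↦ (h·x·(σ·h)⁻¹, n)` preserves `Γ = F̂₂ ×_Ẑ ℤ`; the
homomorphism law is read in `Π_X` (`toHatχq_injective`), bi-continuity from the joint continuity of the stage-2 action.
A MODEL ARTEFACT (for `h ∉ pr₁ Γ` this automorphism is not inner in `Π^tp_X`). [cite: MochizukiEtTh2009, §1 p.12] -/
theorem exists_conjHatAutχq (h : F₂hatT) : ∃ α : PiTpχq p i j ≃ₜ* PiTpχq p i j,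
    ∀ x, toHatχq p i j (α x) = SemidirectProduct.inl h * toHatχq p i j x * (SemidirectProduct.inl h)⁻¹ := by
  -- the left coordinate `(x, n) ↦ (g·x·(σ·g)⁻¹, n)` lands in `Γ` (`ê` is conjugation- and action-invariant)
  have hmem : ∀ (g : F₂hatT) (σ : GQp p) (γ : Gfp),
      ((g * (γ : F₂hatT × Multiplicative ℤ).1 * (actHatχq p i j σ g)⁻¹, (γ : F₂hatT × Multiplicative ℤ).2) :
        F₂hatT × Multiplicative ℤ) ∈ Gfp := by
    intro g σ γ
    rw [mem_Gfp]
    change eHat (g * _ * (actHatχq p i j σ g)⁻¹) = iotaZ (γ : F₂hatT × Multiplicative ℤ).2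
    rw [map_mul, map_inv, eHat_actHatχq, ← map_inv, ← map_mul, eHat_conj]
    exact (mem_Gfp _).mp γ.2
  -- the maps are introduced OPAQUELY (by their coordinates), keeping definitional unfolding out of the way
  obtain ⟨c, hc⟩ : ∃ c : F₂hatT → GQp p → Gfp → Gfp, ∀ g σ γ,
      ((c g σ γ : Gfp) : F₂hatT × Multiplicative ℤ) =
        (g * (γ : F₂hatT × Multiplicative ℤ).1 * (actHatχq p i j σ g)⁻¹, (γ : F₂hatT × Multiplicative ℤ).2) :=
    ⟨fun g σ γ => ⟨_, hmem g σ γ⟩, fun _ _ _ => rfl⟩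
  have hc1 : ∀ g σ γ, gfpFst (c g σ γ) = g * gfpFst γ * (actHatχq p i j σ g)⁻¹ := fun g σ γ => by
    rw [gfpFst_apply, gfpFst_apply, hc]
  have hc_cont : ∀ g, Continuous fun q : GQp p × Gfp => c g q.1 q.2 := by
    intro g
    have ha : Continuous fun q : GQp p × Gfp => actHatχq p i j q.1 g :=
      (continuous_actHatχq_left p i j g).comp (f := fun q : GQp p × Gfp => q.1) continuous_fst
    have h2 : Continuous fun q : GQp p × Gfp => ((q.2 : Gfp) : F₂hatT × Multiplicative ℤ).1 :=
      continuous_fst.comp (continuous_subtype_val.comp continuous_snd)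
    have h4 : Continuous fun q : GQp p × Gfp => ((q.2 : Gfp) : F₂hatT × Multiplicative ℤ).2 :=
      continuous_snd.comp (continuous_subtype_val.comp continuous_snd)
    have h3 : Continuous fun q : GQp p × Gfp =>
        ((g * ((q.2 : Gfp) : F₂hatT × Multiplicative ℤ).1 * (actHatχq p i j q.1 g)⁻¹,
          ((q.2 : Gfp) : F₂hatT × Multiplicative ℤ).2) : F₂hatT × Multiplicative ℤ) :=
      ((continuous_const.mul h2).mul ha.inv).prodMk h4
    rw [continuous_induced_rng, show ((↑) : Gfp → F₂hatT × Multiplicative ℤ) ∘ (fun q : GQp p × Gfp => c g q.1 q.2) =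
      (fun q : GQp p × Gfp => (g * ((q.2 : Gfp) : F₂hatT × Multiplicative ℤ).1 * (actHatχq p i j q.1 g)⁻¹,
        ((q.2 : Gfp) : F₂hatT × Multiplicative ℤ).2)) from funext fun q => hc g q.1 q.2]
    exact h3
  obtain ⟨F, hFl, hFr⟩ : ∃ F : F₂hatT → PiTpχq p i j → PiTpχq p i j,
      (∀ g x, (F g x).left = c g x.right x.left) ∧ ∀ g x, (F g x).right = x.right :=
    ⟨fun g x => ⟨c g x.right x.left, x.right⟩, fun _ _ => rfl, fun _ _ => rfl⟩
  have hF : ∀ g x, toHatχq p i j (F g x) =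
      SemidirectProduct.inl g * toHatχq p i j x * (SemidirectProduct.inl g)⁻¹ := by
    intro g x
    refine SemidirectProduct.ext ?_ ?_
    · rw [toHatχq_left, hFl, hc1, inl_mul_mul_inl_inv_left, toHatχq_left, toHatχq_right]
    · rw [toHatχq_right, hFr, inl_mul_mul_inl_inv_right, toHatχq_right]
  have hF_mul : ∀ g (x y : PiTpχq p i j), F g (x * y) = F g x * F g y := by
    intro g x y
    apply toHatχq_injective p i j
    have e1 := hF g (x * y)
    have e2 : toHatχq p i j (F g x * F g y) = toHatχq p i j (F g x) * toHatχq p i j (F g y) := map_mul _ _ _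
    rw [e1, e2, hF g x, hF g y, map_mul]
    group
  have hF_inv : ∀ g (x : PiTpχq p i j), F g⁻¹ (F g x) = x := by
    intro g x
    apply toHatχq_injective p i j
    rw [hF g⁻¹ (F g x), hF g x, map_inv]
    group
  have hF_cont : ∀ g, Continuous (F g) := by
    intro g
    refine (Semidirect.continuous_iff_left_right (isInducing_leftRightχq p i j)).mpr ⟨?_, ?_⟩
    · rw [show (fun x => (F g x).left) = (fun q : GQp p × Gfp => c g q.1 q.2) ∘ fun x => (x.right, x.left) from
        funext fun x => hFl g x]
      exact (hc_cont g).comp ((Semidirect.continuous_right (isInducing_leftRightχq p i j)).prodMk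
        (Semidirect.continuous_left (isInducing_leftRightχq p i j)))
    · rw [show (fun x => (F g x).right) = fun x => x.right from funext fun x => hFr g x]
      exact Semidirect.continuous_right (isInducing_leftRightχq p i j)
  let e : PiTpχq p i j ≃* PiTpχq p i j :=
    { toFun := F h
      invFun := F h⁻¹
      left_inv := hF_inv h
      right_inv := fun x => by have h' := hF_inv h⁻¹ x; rwa [inv_inv] at h'
      map_mul' := hF_mul h }
  exact ⟨ContinuousMulEquiv.mk e (hF_cont h) (hF_cont h⁻¹), hF h⟩

variable {p i j}

/-- The Galois coordinate is fixed: `α_h` is over the identity of `G_{ℚ_p}`. [cite: MochizukiEtTh2009, §1 p.12] -/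
theorem right_eq_of_conjHat {h : F₂hatT} {α : PiTpχq p i j ≃ₜ* PiTpχq p i j}
    (hα : ∀ x, toHatχq p i j (α x) = SemidirectProduct.inl h * toHatχq p i j x * (SemidirectProduct.inl h)⁻¹)
    (x : PiTpχq p i j) : (α x).right = x.right := by
  have h1 := congrArg SemidirectProduct.right (hα x)
  rwa [inl_mul_mul_inl_inv_right, toHatχq_right, toHatχq_right] at h1

/-- The `F̂₂`-coordinate: `pr₁ (α_h x).left = h · pr₁ x.left · (x.right · h)⁻¹`. [cite: MochizukiEtTh2009, §1 p.12] -/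
theorem gfpFst_left_eq_of_conjHat {h : F₂hatT} {α : PiTpχq p i j ≃ₜ* PiTpχq p i j}
    (hα : ∀ x, toHatχq p i j (α x) = SemidirectProduct.inl h * toHatχq p i j x * (SemidirectProduct.inl h)⁻¹)
    (x : PiTpχq p i j) : gfpFst (α x).left = h * gfpFst x.left * (actHatχq p i j x.right h)⁻¹ := by
  have h1 := congrArg SemidirectProduct.left (hα x)
  rwa [inl_mul_mul_inl_inv_left, toHatχq_left, toHatχq_left, toHatχq_right] at h1

/-- On the geometric part (`x.right = 1`) `α_h` is plain conjugation by `h`: `pr₁ (α_h x).left = h · pr₁ x.left · h⁻¹`.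
[cite: MochizukiEtTh2009, §1 p.12] -/
theorem gfpFst_left_eq_conj_of_conjHat {h : F₂hatT} {α : PiTpχq p i j ≃ₜ* PiTpχq p i j}
    (hα : ∀ x, toHatχq p i j (α x) = SemidirectProduct.inl h * toHatχq p i j x * (SemidirectProduct.inl h)⁻¹)
    {x : PiTpχq p i j} (hx : x.right = 1) : gfpFst (α x).left = h * gfpFst x.left * h⁻¹ := by
  rw [gfpFst_left_eq_of_conjHat hα, hx, map_one, MulAut.one_apply]

/-- The degree `Γ ↠ ℤ` is preserved (read through `ê` and the injectivity of `ι : ℤ → Ẑ`). [cite: MochizukiEtTh2009, §1 p.12] -/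
theorem gfpSnd_left_eq_of_conjHat {h : F₂hatT} {α : PiTpχq p i j ≃ₜ* PiTpχq p i j}
    (hα : ∀ x, toHatχq p i j (α x) = SemidirectProduct.inl h * toHatχq p i j x * (SemidirectProduct.inl h)⁻¹)
    (x : PiTpχq p i j) : gfpSnd (α x).left = gfpSnd x.left := by
  apply iotaZ_injective
  rw [gfpSnd_apply, gfpSnd_apply, ← (mem_Gfp _).mp (α x).left.2, ← (mem_Gfp _).mp x.left.2, ← gfpFst_apply,
    ← gfpFst_apply, gfpFst_left_eq_of_conjHat hα, map_mul, map_inv, eHat_actHatχq, ← map_inv, ← map_mul, eHat_conj]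

/-- The inverse is conjugation by `inl h⁻¹`. [cite: MochizukiEtTh2009, §1 p.12] -/
theorem conjHat_symm {h : F₂hatT} {α : PiTpχq p i j ≃ₜ* PiTpχq p i j}
    (hα : ∀ x, toHatχq p i j (α x) = SemidirectProduct.inl h * toHatχq p i j x * (SemidirectProduct.inl h)⁻¹)
    (x : PiTpχq p i j) :
    toHatχq p i j (α.symm x) = SemidirectProduct.inl h⁻¹ * toHatχq p i j x * (SemidirectProduct.inl h⁻¹)⁻¹ := by
  have h1 := hα (α.symm x)
  rw [ContinuousMulEquiv.apply_symm_apply] at h1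
  rw [h1, map_inv]
  group

/-- **Level invariance.** If `ĥ_N(h) = 1` and `ĥ_N(σ·h) = 1` for all `σ`, then `α_h` preserves the level-`N`
Heisenberg map `ĥ_N ∘ pr₁` on `Γ`. [cite: MochizukiEtTh2009, §1 p.13] -/
theorem levelHom_left_eq_of_conjHat {h : F₂hatT} {α : PiTpχq p i j ≃ₜ* PiTpχq p i j}
    (hα : ∀ x, toHatχq p i j (α x) = SemidirectProduct.inl h * toHatχq p i j x * (SemidirectProduct.inl h)⁻¹)
    {N : ℕ+} (hN : hHat N h = 1) (hNσ : ∀ σ : GQp p, hHat N (actHatχq p i j σ h) = 1) (x : PiTpχq p i j) :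
    levelHom N (α x).left = levelHom N x.left := by
  change hHat N (gfpFst (α x).left) = hHat N (gfpFst x.left)
  rw [gfpFst_left_eq_of_conjHat hα, map_mul, map_mul, map_inv, hN, hNσ, one_mul, inv_one, mul_one]

/-- On the geometric part, `α_h` fixes `ĥ_N ∘ pr₁` whenever `ĥ_N(pr₁ x)` lies in the centre-like `z`-axis
(`x = y = 0`), at EVERY level `N` and for EVERY `h`. [cite: MochizukiEtTh2009, §1 p.12] -/
theorem hHat_left_eq_of_conjHat_of_zAxis {h : F₂hatT} {α : PiTpχq p i j ≃ₜ* PiTpχq p i j}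
    (hα : ∀ x, toHatχq p i j (α x) = SemidirectProduct.inl h * toHatχq p i j x * (SemidirectProduct.inl h)⁻¹)
    {x : PiTpχq p i j} (hx : x.right = 1) (N : ℕ+) (hz : hHat N (gfpFst x.left) ∈ (Heis.zAxis : Subgroup (Heis (ZMod N)))) :
    hHat N (gfpFst (α x).left) = hHat N (gfpFst x.left) := by
  rw [gfpFst_left_eq_conj_of_conjHat hα hx, map_mul, map_mul, map_inv,
    Subgroup.mem_center_iff.mp (Heis.zAxis_le_center hz) (hHat N h), mul_inv_cancel_right]

/-- **`α_h` on `Ker(Π^tp_X ↠ (Π^tp_X)^ell)`**: it stabilises this kernel and induces the IDENTITY on its image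
`Δ_Θ`-part of `(Π^tp_X)^Θ` — `θ(α_h x) = θ(x)` — since `ĥ_N(pr₁ x)` is central at every level. [cite: MochizukiEtTh2009, §1 p.12] -/
theorem ellKer_of_conjHat {h : F₂hatT} {α : PiTpχq p i j ≃ₜ* PiTpχq p i j}
    (hα : ∀ x, toHatχq p i j (α x) = SemidirectProduct.inl h * toHatχq p i j x * (SemidirectProduct.inl h)⁻¹)
    {x : PiTpχq p i j} (hx : x ∈ CurveTheta.ellKer (curveχq p i j)) :
    α x ∈ CurveTheta.ellKer (curveχq p i j) ∧
      CurveTheta.toTheta (curveχq p i j) (α x) = CurveTheta.toTheta (curveχq p i j) x := by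
  have hR := right_eq_of_conjHat hα
  obtain ⟨hxy, hright⟩ := (mem_ellKerχq_iff p i j x).mp hx
  have hlev : ∀ N, hHat N (gfpFst (α x).left) = hHat N (gfpFst x.left) := fun N =>
    hHat_left_eq_of_conjHat_of_zAxis hα hright N (hxy N)
  refine ⟨(mem_ellKerχq_iff p i j _).mpr ⟨fun N => by rw [hlev N]; exact hxy N, by rw [hR, hright]⟩, ?_⟩
  rw [CurveTheta.toTheta, QuotientGroup.mk'_apply, QuotientGroup.mk'_apply, QuotientGroup.eq, mem_thetaKerχq_iff]
  refine ⟨fun N => ?_, by rw [SemidirectProduct.mul_right, SemidirectProduct.inv_right, hR, hright, inv_one, one_mul]⟩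
  rw [SemidirectProduct.mul_left, SemidirectProduct.inv_left, SemidirectProduct.inv_right, hR, hright, inv_one,
    map_one, MulAut.one_apply, MulAut.one_apply, map_mul, map_inv, map_mul, map_inv, hlev N, inv_mul_cancel]

/-! ## §2. The witness `h := a^{s′}`, `s′ ∈ 4l·Ẑ ∖ ℤ` -/

variable (p i j)

/-- `Heis(ℤ/2)` has exponent `4`. [folklore] -/
private theorem heis_two_pow_four (q : Heis (ZMod 2)) : q ^ ((4 : ℕ+) : ℕ) = 1 := by
  have h4 : (((4 : ℕ+) : ℕ) : ZMod 2) = 0 := by decide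
  have h6 : ((((4 : ℕ+) : ℕ).choose 2 : ℕ) : ZMod 2) = 0 := by decide
  rw [Heis.pow_eq_mk, h4, h6, zero_mul, zero_mul, zero_mul, zero_mul, zero_add]
  rfl

/-- **Killing a level by the exponent.** If `π : F̂₂ → Q` is continuous into a group of exponent `e` and `level_e t = 1`,
then `π(y^t) = 1` for every `y ∈ F̂₂`. [cite: MochizukiEtTh2009, §1 p.12] -/
theorem apply_powHat_eq_one_of_level_eq_one {Q : Type*} [Group Q] [TopologicalSpace Q] (π : F₂hatT →ₜ* Q) (e : ℕ+)
    (he : ∀ q : Q, q ^ (e : ℕ) = 1) {t : ZH} (ht : ZHatLevel.level e t = 1) (y : F₂hatT) : π (powHat y t) = 1 := by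
  rw [apply_powHat_eq_pow π e he, ht, toAdd_one, ZMod.val_zero, pow_zero]

include hp in
/-- **The witness exponent**: some `s′ ∈ Ẑ` with `s′ ∉ ℤ`, `level_l s′ = 1` and `level_4 s′ = 1` (`s′ := (s^{2l})²` for
the `s` of `exists_pow_sq_ne_eta`). [cite: RibesZalesskii2010, Thm 2.7.1] -/
theorem exists_zh_not_int_of_level_l_four (l : ℕ+) : ∃ s' : ZH, (∀ m : ℤ, s' ≠ ZHatLevel.eta m) ∧
    ZHatLevel.level l s' = 1 ∧ ZHatLevel.level 4 s' = 1 := by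
  haveI := hp
  obtain ⟨s, hs⟩ := exists_pow_sq_ne_eta p (2 * l) (by positivity)
  refine ⟨(s ^ (2 * (l : ℕ))) ^ 2, hs, ?_, ?_⟩
  · rw [← pow_mul, show 2 * (l : ℕ) * 2 = 4 * l by ring, pow_mul]
    exact ZHatLevel.level_pow_self l _
  · rw [← pow_mul, show 2 * (l : ℕ) * 2 = l * ((4 : ℕ+) : ℕ) by norm_num; ring, pow_mul]
    exact ZHatLevel.level_pow_self 4 _

/-- **The witness `h := a^{s′}`** (`exists_aPowHat`): `ê(h) = s′ ∉ ℤ`, and `ĥ_N(h) = ĥ_N(σ·h) = 1` at `N = l` (odd) and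
`N = 2` (`σ·a^{s′} = (σ·a)^{s′}` by `map_powHat`, then the exponent kills the level). [cite: MochizukiEtTh2009, §1 p.12] -/
theorem exists_aPow_conjHat_witness (l : ℕ+) (hl : Odd (l : ℕ)) : ∃ (h : F₂hatT) (s' : ZH), (∀ m : ℤ, s' ≠ ZHatLevel.eta m) ∧
    eHat h = s' ∧ hHat l h = 1 ∧ (∀ σ : GQp p, hHat l (actHatχq p i j σ h) = 1) ∧
    hHat 2 h = 1 ∧ (∀ σ : GQp p, hHat 2 (actHatχq p i j σ h) = 1) := by
  obtain ⟨s', hs', hl', h4'⟩ := exists_zh_not_int_of_level_l_four p l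
  obtain ⟨A, hAι, hAe⟩ := exists_aPowHat
  have hA : A = powHat (eta (FreeGroup.of 0)) :=
    powHat_unique _ A (by rw [hAι, toAdd_ofAdd, zpow_one])
  have hact : ∀ σ : GQp p, actHatχq p i j σ (A s') = powHat (actHatχq p i j σ (eta (FreeGroup.of 0))) s' := by
    intro σ
    rw [hA]
    exact map_powHat ⟨(actHatχq p i j σ).toMonoidHom, continuous_actHatχq_apply p i j σ⟩ _ s'
  refine ⟨A s', s', hs', hAe s', ?_, fun σ => ?_, ?_, fun σ => ?_⟩
  · rw [hA]; exact apply_powHat_eq_one_of_level_eq_one (hHat l) l (Heis.pow_eq_one_of_odd l hl) hl' _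
  · rw [hact]; exact apply_powHat_eq_one_of_level_eq_one (hHat l) l (Heis.pow_eq_one_of_odd l hl) hl' _
  · rw [hA]; exact apply_powHat_eq_one_of_level_eq_one (hHat 2) 4 heis_two_pow_four h4' _
  · rw [hact]; exact apply_powHat_eq_one_of_level_eq_one (hHat 2) 4 heis_two_pow_four h4' _

/-! ## §3. What `α_h` preserves, and where it is not inner -/

/-- `ĥ_N` of a conjugate of `(0, c, 0)`: `g · (0,c,0) · g⁻¹ = (0, c, g.x · c)` in the Heisenberg group. [folklore] -/
private theorem heis_conj_y {R : Type*} [CommRing R] (g : Heis R) (c : R) :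
    g * (⟨0, c, 0⟩ : Heis R) * g⁻¹ = ⟨0, c, g.x * c⟩ := by
  ext <;> simp; ring

/-- `ι k = η(k)` (both are the image of the integer `k` in `Ẑ`). [cite: RibesZalesskii2010, Thm 2.7.1] -/
private theorem iotaZ_eq_eta (k : Multiplicative ℤ) : iotaZ k = ZHatLevel.eta (Multiplicative.toAdd k) := rfl

variable {p i j}

/-- `α_h` and `Ker(Π^tp_X ↠ (Π^tp_X)^Θ)`: membership is preserved (on the geometric part `α_h` is conjugation by `h`,
and `ĥ_N(h x h⁻¹) = 1 ↔ ĥ_N(x) = 1`). [cite: MochizukiEtTh2009, Cor 2.18 (i) p.60] -/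
theorem conjHat_mem_thetaKer_iff {h : F₂hatT} {α : PiTpχq p i j ≃ₜ* PiTpχq p i j}
    (hα : ∀ x, toHatχq p i j (α x) = SemidirectProduct.inl h * toHatχq p i j x * (SemidirectProduct.inl h)⁻¹)
    (x : PiTpχq p i j) : α x ∈ CurveTheta.thetaKer (curveχq p i j) ↔ x ∈ CurveTheta.thetaKer (curveχq p i j) := by
  rw [mem_thetaKerχq_iff, mem_thetaKerχq_iff, right_eq_of_conjHat hα]
  refine and_congr_left fun hx => forall_congr' fun N => ?_
  rw [gfpFst_left_eq_conj_of_conjHat hα hx, map_mul, map_mul, map_inv, conj_eq_one_iff]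

/-- `α_h` and `Ker(Π^tp_X ↠ (Π^tp_X)^ell)`: membership is preserved (both `α_h` and `α_h⁻¹ = α_{h⁻¹}` map it into
itself). [cite: MochizukiEtTh2009, Cor 2.18 (i) p.60] -/
theorem conjHat_mem_ellKer_iff {h : F₂hatT} {α : PiTpχq p i j ≃ₜ* PiTpχq p i j}
    (hα : ∀ x, toHatχq p i j (α x) = SemidirectProduct.inl h * toHatχq p i j x * (SemidirectProduct.inl h)⁻¹)
    (x : PiTpχq p i j) : α x ∈ CurveTheta.ellKer (curveχq p i j) ↔ x ∈ CurveTheta.ellKer (curveχq p i j) :=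
  ⟨fun hx => by simpa only [ContinuousMulEquiv.symm_apply_apply] using (ellKer_of_conjHat (conjHat_symm hα) hx).1,
    fun hx => (ellKer_of_conjHat hα hx).1⟩

/-- `α_h` and `Π^tp_{Y_2} = Π^tp_Ÿ`: when `ĥ_2(h) = ĥ_2(σ·h) = 1`, membership is preserved (degree, level `2` and the
Galois coordinate are). [cite: MochizukiEtTh2009, Thm 1.6 (i) p.24] -/
theorem conjHat_mem_YNχq_two_iff {h : F₂hatT} {α : PiTpχq p i j ≃ₜ* PiTpχq p i j}
    (hα : ∀ x, toHatχq p i j (α x) = SemidirectProduct.inl h * toHatχq p i j x * (SemidirectProduct.inl h)⁻¹)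
    (h2 : hHat 2 h = 1) (h2σ : ∀ σ : GQp p, hHat 2 (actHatχq p i j σ h) = 1) (x : PiTpχq p i j) :
    α x ∈ YNχq p i j 2 ↔ x ∈ YNχq p i j 2 := by
  change (α x).left ∈ dY 2 ∧ (α x).right ∈ _ ↔ x.left ∈ dY 2 ∧ x.right ∈ _
  rw [right_eq_of_conjHat hα, dY, Subgroup.mem_inf, Subgroup.mem_inf, MonoidHom.mem_ker, MonoidHom.mem_ker,
    Subgroup.mem_comap, Subgroup.mem_comap, gfpSnd_left_eq_of_conjHat hα, levelHom_left_eq_of_conjHat hα h2 h2σ]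

/-- `α_h` and `Π^tp_X̲̲ = Huuχq` (the choice of record): when `ĥ_l(h) = ĥ_l(σ·h) = 1`, membership is preserved.
[cite: MochizukiEtTh2009, Def 2.5 (i) p.39] -/
theorem conjHat_mem_Huuχq_iff {h : F₂hatT} {α : PiTpχq p i j ≃ₜ* PiTpχq p i j}
    (hα : ∀ x, toHatχq p i j (α x) = SemidirectProduct.inl h * toHatχq p i j x * (SemidirectProduct.inl h)⁻¹)
    {l : ℕ+} (hl : Odd (l : ℕ)) (h1 : hHat l h = 1) (h1σ : ∀ σ : GQp p, hHat l (actHatχq p i j σ h) = 1)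
    (x : PiTpχq p i j) : α x ∈ Huuχq p i j l hl ↔ x ∈ Huuχq p i j l hl := by
  rw [mem_Huuχq_iff, mem_Huuχq_iff, levelHom_left_eq_of_conjHat hα h1 h1σ]

/-- **Non-innerness on the geometric part.** If `ê(h) = s′ ∉ ℤ`, then `α_h` differs from EVERY inner automorphism
`Ad(w)`, `w ∈ Π^tp_X`, at the element `b ∈ Δ`: reading `α_h(b) = w b w⁻¹` in `Heis(ℤ/N)` gives
`(0, 1, s′_N) = (0, χ_N(σ), χ_N(σ)·deg w₁)`, so `s′ ≡ deg w₁ (mod N)` for all `N`, i.e. `s′ ∈ ℤ`. [cite: MochizukiEtTh2009, §1 p.12] -/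
theorem conjHat_inl_b_ne_conj {h : F₂hatT} {α : PiTpχq p i j ≃ₜ* PiTpχq p i j}
    (hα : ∀ x, toHatχq p i j (α x) = SemidirectProduct.inl h * toHatχq p i j x * (SemidirectProduct.inl h)⁻¹)
    {s' : ZH} (hse : eHat h = s') (hs' : ∀ m : ℤ, s' ≠ ZHatLevel.eta m) (w : PiTpχq p i j) :
    α (SemidirectProduct.inl (gfpOf (FreeGroup.of 1))) ≠
      w * SemidirectProduct.inl (gfpOf (FreeGroup.of 1)) * w⁻¹ := by
  intro heq
  -- read the equation in `Π_X`, then in `F̂₂`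
  have h2 : toHatχq p i j (SemidirectProduct.inl (gfpOf (FreeGroup.of 1))) =
      SemidirectProduct.inl (eta (FreeGroup.of 1)) :=
    SemidirectProduct.ext (by rw [toHatχq_left, SemidirectProduct.left_inl, SemidirectProduct.left_inl]; rfl)
      (by rw [toHatχq_right, SemidirectProduct.right_inl, SemidirectProduct.right_inl])
  have h1 := congrArg (toHatχq p i j) heq
  rw [hα, map_mul, map_mul, map_inv, h2, conj_inl_eq_sd, conj_inl_eq_sd, SemidirectProduct.left_inl,
    SemidirectProduct.right_inl, map_one, MulAut.one_apply, toHatχq_left, toHatχq_right, actHatχq_apply,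
    affTwist₃_eta_of_one] at h1
  have h3 := SemidirectProduct.inl_injective h1
  -- compare `ĥ_N` of both sides at every level `N`: `(0, 1, s′_N) = (0, χ_N, χ_N · deg w₁)`
  have key : ∀ N : ℕ+, ZHatLevel.level N s' =
      ZHatLevel.level N (iotaZ (w.left : F₂hatT × Multiplicative ℤ).2) := by
    intro N
    have h4 := congrArg (hHat N) h3
    simp only [map_mul, map_inv, hHat_eta, heisHom_of_one, Heis.map_apply, map_zero, map_one, hHat_bPow,
      heis_conj_y, mul_one, Heis.ext_iff, true_and] at h4
    obtain ⟨hc, hz⟩ := h4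
    rw [← hc, mul_one] at hz
    rw [← modN_eq_level, ← modN_eq_level, ← hse, ← (mem_Gfp _).mp w.left.2, ← gfpFst_apply,
      ← hHat_x_eq_modN_eHat, ← hHat_x_eq_modN_eHat, hz]
  have hs1 : s' * (iotaZ (w.left : F₂hatT × Multiplicative ℤ).2)⁻¹ = 1 :=
    zh_eq_one_of_forall_level fun N => by rw [map_mul, map_inv, key N, mul_inv_cancel]
  exact hs' _ (by rw [← iotaZ_eq_eta]; exact mul_inv_eq_one.mp hs1)

end SettingModel

end Literature.AnabelianGeometry.EtaleTheta

end
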